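import Mathlib
import Summits.ResolutionOfSingularities.ResolutionOfSingularities.Theorems.WildQuotientsWildQuotientResolutionBlowupLocalExitThree

/-!
# The exit downstairs on a glued quotient `X/G`: two- and three-piece skeletons

Crux stmt-ResolutionOfSingularities-15640 (`WildQuotients.WildQuotientResolution`), line `Sketch`;
chain w45c, programmes V3U (two pieces) and V4U (three pieces): the DOWNSTAIRS assembly as one
theorem with the piece data as hypotheses (res-L1-w45c-stub-3). [OURS · L1 W4.5c] — generic glue,
NOT a statement of the manuscript.

`ρ` an action of the finite group `G` on `X` over `S`, `X/G = ρ.glued` (Mumford gluing of the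
pieces `O/G`), assumed integral and locally Noetherian (for the linear programmes: Q1 p479608).
Given stable affine opens `Oⱼ` covering `X`, a closed `Z ⊆ X/G`, `Z ≠ X/G`, missing the chart of the
LAST piece whose quotient is regular (Király–Lütkebohmert terminal piece: p488078), and on each other
piece SOME regular blow-up of `Oⱼ/G` along `𝓘_Z|` (explicit toric charts, transported by p489276):
then `X/G` has a resolution of singularities — any blow-up of `X/G` along `𝓘_Z`
(`hasResolution_glued_of_two_pieces`, `hasResolution_glued_of_three_pieces`).
-/

-- single-problem summit: the doubled namespace component `ResolutionOfSingularities` is forced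
set_option linter.dupNamespace false

noncomputable section

universe u

open CategoryTheory AlgebraicGeometry TopologicalSpace
open Literature.AlgebraicGeometry.Resolution Literature.AlgebraicGeometry.RelativeSpec

namespace Summit.ResolutionOfSingularities.ResolutionOfSingularities.Theorems.WildQuotientResolution.BlowupExit

variable {X S : Scheme.{u}} {r : X ⟶ S} {G : Type u} [Group G] [Finite G]
  (ρ : ActionOver r G) [S.IsSeparated] [IsSeparated r]

/-- **Two-piece exit on `X/G`** (V3U shape: `O₁` = the cone chart, `O₂` = the terminal chart).
[cite: GortzWedhorn2020, Prop. 13.91–13.92] -/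
theorem hasResolution_glued_of_two_pieces [IsIntegral ρ.glued] [IsLocallyNoetherian ρ.glued]
    (hcov : ∀ x : X, ∃ O : ρ.StableAffineOpens, x ∈ O.1)
    (O₁ O₂ : ρ.StableAffineOpens) (hO : O₁.1 ⊔ O₂.1 = ⊤)
    (Z : Closeds ρ.glued) (hZ : (Z : Set ρ.glued) ≠ Set.univ)
    (hZ₂ : Disjoint (Set.range (ρ.gluedι O₂).base) (Z : Set ρ.glued))
    (hQ : Scheme.IsRegular (ρ.pieceQuot O₂))
    (hP₁ : ∃ (B : Scheme.{u}) (p : B ⟶ ρ.pieceQuot O₁),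
      IsBlowup p ((Scheme.IdealSheafData.vanishingIdeal Z).comap (ρ.gluedι O₁)) ∧
        Scheme.IsRegular B) :
    Scheme.HasResolution ρ.glued := by
  have hne : Scheme.IdealSheafData.vanishingIdeal Z ≠ ⊥ := fun h => hZ <| by
    rw [← Scheme.IdealSheafData.coe_support_vanishingIdeal Z, h,
      Scheme.IdealSheafData.support_bot]
    rfl
  exact hasResolution_of_isBlowup_local_of_isOpenImmersion _ hne (ρ.gluedι O₁) (ρ.gluedι O₂)
    (opensRange_gluedι_sup_eq_top ρ hcov O₁ O₂ hO) hQ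
    (comap_vanishingIdeal_eq_top_of_disjoint Z _ hZ₂) hP₁

/-- **Three-piece exit on `X/G`** (V4U shape: `O₀, O₁` = the `μ₃`- and `μ₂`-vertex charts of
`Bl_{I₆}𝔸⁴`, `O₂` = the smooth vertex chart on which the lifted `σ` is terminal).
[cite: GortzWedhorn2020, Prop. 13.91–13.92] -/
theorem hasResolution_glued_of_three_pieces [IsIntegral ρ.glued] [IsLocallyNoetherian ρ.glued]
    (hcov : ∀ x : X, ∃ O : ρ.StableAffineOpens, x ∈ O.1)
    (O₀ O₁ O₂ : ρ.StableAffineOpens) (hO : O₀.1 ⊔ O₁.1 ⊔ O₂.1 = ⊤)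
    (Z : Closeds ρ.glued) (hZ : (Z : Set ρ.glued) ≠ Set.univ)
    (hZ₂ : Disjoint (Set.range (ρ.gluedι O₂).base) (Z : Set ρ.glued))
    (hQ : Scheme.IsRegular (ρ.pieceQuot O₂))
    (hP₀ : ∃ (B : Scheme.{u}) (p : B ⟶ ρ.pieceQuot O₀),
      IsBlowup p ((Scheme.IdealSheafData.vanishingIdeal Z).comap (ρ.gluedι O₀)) ∧
        Scheme.IsRegular B)
    (hP₁ : ∃ (B : Scheme.{u}) (p : B ⟶ ρ.pieceQuot O₁),
      IsBlowup p ((Scheme.IdealSheafData.vanishingIdeal Z).comap (ρ.gluedι O₁)) ∧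
        Scheme.IsRegular B) :
    Scheme.HasResolution ρ.glued := by
  have hne : Scheme.IdealSheafData.vanishingIdeal Z ≠ ⊥ := fun h => hZ <| by
    rw [← Scheme.IdealSheafData.coe_support_vanishingIdeal Z, h,
      Scheme.IdealSheafData.support_bot]
    rfl
  exact hasResolution_of_isBlowup_local_of_isOpenImmersion₃ _ hne (ρ.gluedι O₀) (ρ.gluedι O₁)
    (ρ.gluedι O₂) (opensRange_gluedι_sup₃_eq_top ρ hcov O₀ O₁ O₂ hO) hQ
    (comap_vanishingIdeal_eq_top_of_disjoint Z _ hZ₂) hP₀ hP₁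

/-- **The closed set downstairs from a closed set upstairs** (for `Z` above): the image under
`X → X/G` of a closed `T ⊆ X` contained in the stable open `O₁` and missing the stable open `O₂`,
with `O₁ ∪ O₂ = X`, as a `Closeds` of `X/G` disjoint from the chart `O₂/G`
(`isClosed_gluedMk_image`, p485627). [folklore] -/
theorem exists_closeds_image_gluedMk (hcov : ∀ x : X, ∃ O : ρ.StableAffineOpens, x ∈ O.1)
    (O₁ O₂ : ρ.StableAffineOpens) (h : O₁.1 ⊔ O₂.1 = ⊤)
    (T : Set X) (hT : IsClosed T) (hT₁ : T ⊆ (O₁.1 : Set X)) (hT₂ : Disjoint T (O₂.1 : Set X)) :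
    ∃ Z : Closeds ρ.glued, (Z : Set ρ.glued) = (ρ.gluedMk hcov).base '' T ∧
      Disjoint (Set.range (ρ.gluedι O₂).base) (Z : Set ρ.glued) := by
  obtain ⟨hcl, hdisj⟩ := isClosed_gluedMk_image ρ hcov O₁ O₂ h T hT hT₁ hT₂
  exact ⟨⟨_, hcl⟩, rfl, hdisj.symm⟩

end Summit.ResolutionOfSingularities.ResolutionOfSingularities.Theorems.WildQuotientResolution.BlowupExit

end
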